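import Literature.AlgebraicGeometry.HodgeTheory.SemiregularityHigherSigma
import HarnessLib

/-!
# The real Buchweitz–Flenner semiregularity map `σ : Ext²(E, E) → ∏_q H^{q+2}(X, Ω^q_{X/S})`
# and semiregularity of a vector bundle (`SemiregularityMapReal`)

For a commutative ring `S`, an `S`-scheme `X : Over (Spec S)` and a finite locally free `𝒪_X`-module `E`
(`hE : Motives.IsFiniteLocallyFree E`) the tree has, ON REAL CARRIERS (Mathlib's `Abelian.Ext` in
`X.Modules`, the Hodge cohomology groups `Motives.hodgeCohomology X q (q + 2) = H^{q+2}(X, ⋀^q Ω¹_{X/S})`):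
the Atiyah class `atiyahClass E` (`HodgeTheory/AtiyahClass.lean`), the components
`sigmaZero = Tr : Ext²(E, E) → H²(X, 𝒪_X)`, `sigmaOne = Tr(∗ · At) : Ext²(E, E) → H³(X, Ω¹)` and the
predicates `IsZeroSemiregular`, `IsOneSemiregular`, `IsZeroOneSemiregular`
(`HodgeTheory/AtiyahClassTraceReal.lean`), and for EVERY form degree `q` the component
`sigmaHigher hE q = Tr_{Ω^q}(∗ · At(E)^q) : Ext²(E, E) → H^{q+2}(X, Ω^q)` with `IsHigherSemiregular`,
`IsISemiregular` and the PROVED identifications of `sigmaHigher hE 0`, `sigmaHigher hE 1` with `sigmaZero`,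
`sigmaOne` (`HodgeTheory/SemiregularityHigherSigma.lean`). This file assembles them into the object
Buchweitz–Flenner actually define and use as a hypothesis — everything is a `def` with a body or a proved
theorem, no named facts:

* `atiyahPowReal E q = At(E)^q ∈ Ext^q(E, E ⊗ Ω^q)` (`E ⊗ Ω^q` modelled as `twistHodge E q = 𝓗om(E^∨, Ω^q)`):
  `E → E ⊗ Ω⁰` followed by the Yoneda power of the Atiyah steps (§1: "Taking powers gives elements
  `At^q(F) ∈ Ext^q_X(F, F ⊗ Ω^q_X)`"); `atiyahPowReal_zero`, `atiyahPowReal_succ`, and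
  **`atiyahPowReal_one : At(E)^1 = At(E) · (Ω¹ ≅ ⋀¹Ω¹)⁻¹`** — the first power IS the real Atiyah class;
* `sigmaReal hE q : Ext²(E, E) →+ H^{q+2}(X, Ω^q)` — the components (`= sigmaHigher hE q`), with
  `sigmaReal_apply : σ_q(x) = Tr_{Ω^q}(x · At(E)^q)`;
* **`semiregularityMapReal hE : Ext²(E, E) →+ ∏_q H^{q+2}(X, Ω^q_{X/S})`**, `σ = (σ_q)_{q ≥ 0}` — Def. 4.1:
  "The map `σ := Tr(∗ · exp(−At(F))) : Ext²_X(F, F) → ∏_k H^{k+2}(X, Λ^k 𝕃_{X/Y})` is called the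
  semiregularity map for `F`";
* **`IsSemiregularReal hE`** — `σ` is injective ("If `σ` is injective then `S` is smooth", Thm. 7.2 (2) /
  Thm. 7.3; Perry Def. 2.4 "semiregular"), `isSemiregularReal_iff` (joint kernel of all `σ_q` is zero),
  `isISemiregular_univ_iff_isSemiregularReal`, `IsISemiregular.isSemiregularReal`,
  `IsHigherSemiregular.isSemiregularReal`, `IsSemiregularReal.isISemiregular_of_eq_zero`;
* degrees `0`, `1` (from the comparisons of `SemiregularityHigherSigma.lean`):
  `hodgeCohomologyZeroAddEquiv_sigmaReal_zero` (`σ_0 = Tr` under `H²(X, Ω⁰) ≃+ H²(X, 𝒪_X)`),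
  `hodgeCohomologyOneAddEquiv_sigmaReal_one` (`σ_1 = sigmaOne` under `H³(X, ⋀¹Ω¹) ≃+ H³(X, Ω¹)`),
  `sigmaReal_zero_eq_zero_iff`, `sigmaReal_one_eq_zero_iff`, `isHigherSemiregular_zero_iff`,
  `isHigherSemiregular_one_iff`, `isISemiregular_zero_one_iff : IsISemiregular hE {0,1} ↔ IsZeroOneSemiregular hE`,
  and **`IsZeroOneSemiregular.isSemiregularReal`**, `IsZeroSemiregular.isSemiregularReal`,
  `IsOneSemiregular.isSemiregularReal`;
* finite dimension (Grothendieck vanishing `Motives.subsingleton_hodgeCohomology_of_lt`, Hartshorne III.2.7):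
  `sigmaReal_eq_zero_of_lt` (`σ_q = 0` when `dim X < q + 2`),
  `isSemiregularReal_iff_isISemiregular_Iio` (on a noetherian `X` of dimension `< n + 2`, semiregular `↔`
  `{0, …, n−1}`-semiregular — BF §5 accordingly take `I ⊆ {0, …, dim X}`),
  `isSemiregularReal_iff_forall_eq_zero_of_lt_two` (dimension `≤ 1`: semiregular `↔` `Ext²(E, E) = 0`).

## Conventions and scope

* NORMALISATION (as in `SemiregularityHigherSigma.lean`): `σ_q = Tr(∗ · At(E)^q)` WITHOUT the unit
  `(−1)^q/q!` of `exp(−At)` (BF) / `τ_q = ((−1)^q/q!) Tr(At(F)^q ·)` (Bandiera–Lepri–Manetti §1): the targets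
  `H^{q+2}(X, Ω^q)` are abelian groups only (no `S`-module structure at the pin) and `1/q!` is not integral.
  The kernel of `σ_q` — all that `IsSemiregularReal` sees — is unchanged whenever `q!` acts invertibly on
  `H^{q+2}(X, Ω^q)`: always in characteristic `0` (the setting of BF, Perry, and of the Hodge-conjecture
  consumers), and for `q < p` in characteristic `p`. Signs (`At` vs `−At`, side of the wedge) never matter.
* INDEXING: components are indexed by the FORM degree `q` (`σ_q : Ext² → H^{q+2}(Ω^q)`), as in BF §1 and
  Def. 4.1; BF §5 index the same component by `p = q + 1` (`Ext² → H^{p+1}(Ω^{p−1})`), so their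
  `I`-semiregularity is `IsISemiregular hE {q | q + 1 ∈ I}`.
* GENERALITY: `X/S` any `S`-scheme and `Ω¹_{X/S}` the cotangent SHEAF (BF: complex spaces / the cotangent
  complex `𝕃_{X/Y}`, `Λ^q 𝕃 = Ω^q` for `X/Y` smooth); `F = E` a vector bundle (BF: perfect complexes — the
  trace on perfect complexes is not in the tree). TODO(general form): perfect complexes, `𝕃_{X/S}`.
* Not here (statements ABOUT `σ`, to be vendored as facts/theorems citing this definition): BF Prop. 4.2 /
  Cor. 4.3 (`σ` and the derivation `⟨ξ, −⟩`, obstructions `ob(ξ)` in `ker σ_I`), the semiregularity theorems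
  (Bloch, BF Thm. 5.1 variational Hodge, Thm. 7.2–7.3 smoothness, Pridham, Perry Thm. 1.1), and the
  re-vendoring of `BuchweitzFlenner2003_variationalHodge_semiregular` / `Perry2026_semiregular_remainsAlgebraic`
  with `IsSemiregularReal` as hypothesis.

Requested by `defn-SemiregularityMapReal` (line `Cruxes/WeilTwelvefoldsSqrtMinus7/Lines/polya-glued-box-products`,
stmt-HodgeConjecture-1261: semiregularity of the Pólya-glued bundle on an abelian 12-fold, Weil class in
`ch₆`, where `{0,1}`-semiregularity is excluded and all `σ_q`, `q ≤ 10`, are needed).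

## References

* [BuchweitzFlenner2003] R.-O. Buchweitz, H. Flenner, *A semiregularity map for modules and applications to
  deformations*, Compositio Math. 137 (2003) 135–210 (arXiv:math/9912245, read: held text): §1 (`At^q`,
  `σ_q = Tr ∘ (∗ · (−At)^q/q!)`, "`k`-semiregular"), §4 Def. 4.1 (the semiregularity map `σ`), §5
  ("`ℰ₀` is called `I`-semiregular if the part `σ_I` … is injective", `I ⊆ {0, …, n}`, `n = dim X₀`),
  Thm. 7.2 (2), Thm. 7.3 ("if `σ` is injective then `S` is smooth").
* [Perry2026Semiregularity] A. Perry, *The semiregularity theorem for equivariant noncommutative varieties*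
  (arXiv:2604.00511), Def. 2.4 (semiregular: `σ²_E` injective), Rem. 2.5 (identification with the
  Buchweitz–Flenner map via HKR).
* [BandieraLepriManetti2023] R. Bandiera, E. Lepri, M. Manetti, Adv. Math. 435 (2023), §1 (`τ_q`).
* [Hartshorne1977] R. Hartshorne, *Algebraic Geometry* (1977), III Thm. 2.7 (Grothendieck vanishing),
  II Ex. 5.1 (`E^∨∨ ≅ E`, `𝓗om(E^∨, G) ≅ E ⊗ G`).
-/

noncomputable section

open CategoryTheory CategoryTheory.Abelian AlgebraicGeometry Opposite TopologicalSpace Limits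

namespace Literature.AlgebraicGeometry.HodgeTheory

open Literature.AlgebraicGeometry.Modules Literature.AlgebraicGeometry.Motives

universe w u

variable {S : Type u} [CommRing S] {X : Over (Spec (CommRingCat.of S))}

/-! ### The powers `At(E)^q ∈ Ext^q(E, E ⊗ Ω^q)` of the Atiyah class -/

section AtiyahPow

variable (E : X.left.Modules) [HasExt.{w} X.left.Modules]

/-- **The `q`-th power of the Atiyah class** `At(E)^q ∈ Ext^q_{𝒪_X}(E, E ⊗ Ω^q_{X/S})` (target modelled
as `twistHodge E q = 𝓗om(E^∨, Ω^q)`, `≅ E ⊗ Ω^q` for `E` finite locally free): `E → E ⊗ Ω⁰`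
(`toTwistHodgeZero`: biduality and `𝒪 ≅ Ω⁰`) followed by the Yoneda power `atiyahClassPower E q` of the
Atiyah steps of `SemiregularityHigherSigma.lean`. Buchweitz–Flenner §1: "Taking powers gives elements
`At^q(F) ∈ Ext^q_X(F, F ⊗ Ω^q_X)`"; in degree `1` this IS the real Atiyah class `atiyahClass E` of
`HodgeTheory/AtiyahClass.lean` placed in `⋀¹ Ω¹ ≅ Ω¹` (`atiyahPowReal_one`). Conventions (sign of `At`,
side of the wedge) only affect signs. [cite: BuchweitzFlenner2003, §1 (At^q) and §4 (Def. 4.1)] -/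
def atiyahPowReal (q : ℕ) : Ext.{w} E (twistHodge E q) q :=
  (Ext.mk₀ (toTwistHodgeZero E)).comp (atiyahClassPower E q) (zero_add q)

/-- `At(E)^0 = [E → E ⊗ Ω⁰]` (the class of `toTwistHodgeZero`). [folklore] -/
theorem atiyahPowReal_zero : atiyahPowReal.{w} E 0 = Ext.mk₀ (toTwistHodgeZero E) := by
  rw [atiyahPowReal, atiyahClassPower_zero, Ext.mk₀_comp_mk₀, Category.comp_id]

/-- `At(E)^{q+1} = At(E)^q · at_q(E)`. [folklore] -/
theorem atiyahPowReal_succ (q : ℕ) :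
    atiyahPowReal.{w} E (q + 1) = (atiyahPowReal E q).comp (atiyahClassStep E q) rfl := by
  rw [atiyahPowReal, atiyahPowReal, atiyahClassPower_succ]
  exact (Ext.comp_assoc _ _ _ (zero_add q) rfl (by omega)).symm

/-- **`At(E)^1` is the Atiyah class**: `At(E)^1 = At(E) · (Ω¹ ≅ ⋀¹ Ω¹)⁻¹` in `Ext¹(E, 𝓗om(E^∨, ⋀¹ Ω¹))`
(`atiyahClass_comp_hodgeSheafOneIso_inv` of `SemiregularityHigherSigma.lean`).
[cite: BuchweitzFlenner2003, §3 (Atiyah class)] -/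
theorem atiyahPowReal_one :
    atiyahPowReal.{w} E 1 =
      (atiyahClass E).comp (Ext.mk₀ (sheafHomMap (dual E) (hodgeSheafOneIso X).inv)) (add_zero 1) := by
  rw [atiyahPowReal_succ, atiyahPowReal_zero, atiyahClass_comp_hodgeSheafOneIso_inv]

end AtiyahPow

/-! ### The semiregularity map and semiregularity -/

section Map

variable [HasExt.{w} X.left.Modules] {E : X.left.Modules} (hE : IsFiniteLocallyFree E)

/-- **The component `σ_q : Ext²_{𝒪_X}(E, E) → H^{q+2}(X, Ω^q_{X/S})`** of the real semiregularity map, for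
EVERY form degree `q : ℕ`: `σ_q(x) = Tr_{Ω^q}(x · At(E)^q)` — the tree's uniform family `sigmaHigher hE q`
of `HodgeTheory/SemiregularityHigherSigma.lean` (trace with coefficients `Ω^q = ⋀^q Ω¹_{X/S}` of the
Yoneda composite with `At(E)^q`, `sigmaReal_apply`), under the name used by the full map
`semiregularityMapReal`. In degrees `0`, `1` it IS `sigmaZero = Tr` and `sigmaOne = Tr(∗ · At)` of
`HodgeTheory/AtiyahClassTraceReal.lean` under `Ω⁰ ≅ 𝒪_X`, `⋀¹ Ω¹ ≅ Ω¹`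
(`hodgeCohomologyZeroAddEquiv_sigmaReal_zero`, `hodgeCohomologyOneAddEquiv_sigmaReal_one`).
Buchweitz–Flenner's component is `((−1)^q/q!) · σ_q` ("`σ_q` is the composition of `∗ · (−At(F))^q/q!`
and the trace", §1); the unit `(−1)^q/q!` is not carried by the abelian group `H^{q+2}(X, Ω^q)` and does
not change the kernel when `q!` is invertible on it. [cite: BuchweitzFlenner2003, §1 (σ_q) and Def. 4.1]
[cite: BandieraLepriManetti2023, §1 (τ_q = ((−1)^q/q!) Tr(At(F)^q ·))] -/
abbrev sigmaReal (q : ℕ) : Ext.{w} E E 2 →+ hodgeCohomology X q (q + 2) :=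
  sigmaHigher hE q

/-- Unfolding `σ_q`: `σ_q(x) = Tr_{Ω^q}(x · At(E)^q)` with `At(E)^q = atiyahPowReal E q ∈ Ext^q(E, E ⊗ Ω^q)`.
[cite: BuchweitzFlenner2003, §1 (σ_q) and Def. 4.1] -/
theorem sigmaReal_apply (q : ℕ) (x : Ext.{w} E E 2) :
    sigmaReal hE q x =
      traceCoeffToCohomology hE (hodgeSheaf X q) (q + 2) (x.comp (atiyahPowReal E q) (add_comm 2 q)) := by
  rw [sigmaReal, sigmaHigher_apply, atiyahPowReal, ← Ext.comp_assoc_of_second_deg_zero]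

/-- **The real Buchweitz–Flenner semiregularity map**
`σ = (σ_q)_{q ≥ 0} : Ext²_{𝒪_X}(E, E) → ∏_{q ≥ 0} H^{q+2}(X, Ω^q_{X/S})` of a finite locally free
`𝒪_X`-module `E` on an `S`-scheme `X`, ON REAL CARRIERS (Mathlib's `Ext` of `X.Modules`; the tree's Hodge
cohomology `Motives.hodgeCohomology X q (q + 2) = H^{q+2}(X, ⋀^q Ω¹_{X/S})`): the product over all form
degrees of the components `sigmaReal hE q = Tr_{Ω^q}(∗ · At(E)^q)`. Buchweitz–Flenner, Def. 4.1: "The map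
`σ := Tr(∗ · exp(−At(F))) : Ext²_X(F, F) → ∏_k H^{k+2}(X, Λ^k 𝕃_{X/Y})` is called the semiregularity map
for `F`" (`𝕃_{X/Y} = Ω¹_{X/Y}` for `X → Y` smooth; here the cotangent SHEAF `Ω¹_{X/S}` of any `S`-scheme and
a vector bundle `F = E` — perfect complexes / coherent `F` need the trace on perfect complexes, not in the
tree), componentwise WITHOUT the units `(−1)^k/k!` of `exp(−At)` (same kernel in characteristic `0`, and on
the components `k < p` in characteristic `p`). [cite: BuchweitzFlenner2003, Def. 4.1] -/
def semiregularityMapReal : Ext.{w} E E 2 →+ ((q : ℕ) → hodgeCohomology X q (q + 2)) :=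
  AddMonoidHom.pi fun q => sigmaReal hE q

/-- Components of the semiregularity map: `σ(x)_q = σ_q(x)`. [cite: BuchweitzFlenner2003, Def. 4.1] -/
@[simp]
lemma semiregularityMapReal_apply (x : Ext.{w} E E 2) (q : ℕ) :
    semiregularityMapReal hE x q = sigmaReal hE q x := rfl

/-- **`E` is semiregular** (on real carriers): the semiregularity map
`σ : Ext²(E, E) → ∏_q H^{q+2}(X, Ω^q_{X/S})` is INJECTIVE — the hypothesis of Buchweitz–Flenner's
smoothness theorems ("If `σ` is injective then `S` is smooth", Thm. 7.2 (2), Thm. 7.3; the variational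
Hodge theorem 5.1 uses the `I`-graded form, the tree's `IsISemiregular`) and Perry's "semiregular" objects
(Def. 2.4; Rem. 2.5 identifies his `σ` with the Buchweitz–Flenner map). Equivalently: the joint kernel of
all `σ_q`, `q ≥ 0`, is zero (`isSemiregularReal_iff`); it is implied by the tree's `{0,1}`-semiregularity
(`IsZeroOneSemiregular.isSemiregularReal`) and by `I`-semiregularity for any `I`
(`IsISemiregular.isSemiregularReal`). [cite: BuchweitzFlenner2003, Def. 4.1 and Thm. 7.3]
[cite: Perry2026Semiregularity, Def. 2.4 and Rem. 2.5] -/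
def IsSemiregularReal {E : X.left.Modules} (hE : IsFiniteLocallyFree E) : Prop :=
  Function.Injective (semiregularityMapReal.{w} hE)

/-- Semiregularity as a joint-kernel condition: `(∀ q, σ_q(x) = 0) ⇒ x = 0`.
[cite: BuchweitzFlenner2003, Def. 4.1] -/
theorem isSemiregularReal_iff :
    IsSemiregularReal hE ↔ ∀ x : Ext.{w} E E 2, (∀ q, sigmaReal hE q x = 0) → x = 0 := by
  rw [IsSemiregularReal, injective_iff_map_eq_zero]
  refine forall_congr' fun x => ?_
  rw [funext_iff]
  rfl

/-- Semiregular `↔` `I`-semiregular (`SemiregularityHigherSigma.IsISemiregular`) for `I` = all form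
degrees. [cite: BuchweitzFlenner2003, §5 (I-semiregular)] -/
theorem isISemiregular_univ_iff_isSemiregularReal :
    IsISemiregular.{w} hE Set.univ ↔ IsSemiregularReal hE := by
  rw [isSemiregularReal_iff]
  exact ⟨fun h x hx => h x fun q _ => hx q, fun h x hx => h x fun q => hx q (Set.mem_univ q)⟩

/-- `I`-semiregular for some set `I` of form degrees ⇒ semiregular. [cite: BuchweitzFlenner2003, §5] -/
theorem IsISemiregular.isSemiregularReal {I : Set ℕ} (h : IsISemiregular.{w} hE I) :
    IsSemiregularReal hE :=
  (isISemiregular_univ_iff_isSemiregularReal hE).1 (IsISemiregular.mono hE (Set.subset_univ I) h)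

/-- `q`-semiregular for some `q` (`σ_q` injective) ⇒ semiregular. [cite: BuchweitzFlenner2003, §1 (k-semiregular)] -/
theorem IsHigherSemiregular.isSemiregularReal {q : ℕ} (h : IsHigherSemiregular.{w} hE q) :
    IsSemiregularReal hE :=
  IsISemiregular.isSemiregularReal hE ((isHigherSemiregular_iff_isISemiregular_singleton hE q).1 h)

/-- A partial converse of `IsISemiregular.isSemiregularReal`: if every component `σ_q`, `q ∉ I`,
vanishes identically, then semiregular ⇒ `I`-semiregular (used with Grothendieck vanishing below,
`isSemiregularReal_iff_isISemiregular_Iio`). [cite: BuchweitzFlenner2003, §5] -/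
theorem IsSemiregularReal.isISemiregular_of_eq_zero {I : Set ℕ} (h : IsSemiregularReal.{w} hE)
    (hI : ∀ q, q ∉ I → sigmaReal hE q = 0) : IsISemiregular hE I := fun x hx =>
  (isSemiregularReal_iff hE).1 h x fun q => by
    by_cases hq : q ∈ I
    · exact hx q hq
    · rw [hI q hq, AddMonoidHom.zero_apply]

end Map

/-! ### Degrees `0` and `1`: `σ_0 = Tr`, `σ_1 = Tr(∗ · At)` of `AtiyahClassTraceReal.lean` -/

section LowDegrees

variable [HasExt.{w} X.left.Modules] {E : X.left.Modules} (hE : IsFiniteLocallyFree E)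

/-- **`σ_0 = Tr`** under `H²(X, Ω⁰) ≃+ H²(X, 𝒪_X)` (`Motives.hodgeCohomologyZeroAddEquiv`): the degree-`0`
component of the real semiregularity map is `sigmaZero = Tr : Ext²(E, E) → H²(X, 𝒪_X)`
(`hodgeCohomologyZeroAddEquiv_sigmaHigher_zero`). [cite: BuchweitzFlenner2003, §1 (σ_0 = Tr)] -/
theorem hodgeCohomologyZeroAddEquiv_sigmaReal_zero (x : Ext.{w} E E 2) :
    hodgeCohomologyZeroAddEquiv X 2 (sigmaReal hE 0 x) = sigmaZero hE x :=
  hodgeCohomologyZeroAddEquiv_sigmaHigher_zero hE x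

/-- **`σ_1 = Tr(∗ · At)`** under `H³(X, ⋀¹ Ω¹) ≃+ H³(X, Ω¹_{X/S})` (`Motives.hodgeCohomologyOneAddEquiv`):
the degree-`1` component of the real semiregularity map is `sigmaOne` of `AtiyahClassTraceReal.lean`
(`hodgeCohomologyOneAddEquiv_sigmaHigher_one`). [cite: BuchweitzFlenner2003, Def. 4.1] -/
theorem hodgeCohomologyOneAddEquiv_sigmaReal_one (x : Ext.{w} E E 2) :
    hodgeCohomologyOneAddEquiv X 3 (sigmaReal hE 1 x) = sigmaOne hE x :=
  hodgeCohomologyOneAddEquiv_sigmaHigher_one hE x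

/-- `σ_0 = Tr` as maps: `(H²(Ω⁰) ≃ H²(𝒪)) ∘ σ_0 = sigmaZero`. [cite: BuchweitzFlenner2003, §1 (σ_0 = Tr)] -/
theorem hodgeCohomologyZeroAddEquiv_comp_sigmaReal_zero :
    (hodgeCohomologyZeroAddEquiv X 2).toAddMonoidHom.comp (sigmaReal.{w} hE 0) = sigmaZero hE :=
  AddMonoidHom.ext (hodgeCohomologyZeroAddEquiv_sigmaReal_zero hE)

/-- `σ_1 = sigmaOne` as maps: `(H³(⋀¹Ω¹) ≃ H³(Ω¹)) ∘ σ_1 = sigmaOne`. [cite: BuchweitzFlenner2003, Def. 4.1] -/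
theorem hodgeCohomologyOneAddEquiv_comp_sigmaReal_one :
    (hodgeCohomologyOneAddEquiv X 3).toAddMonoidHom.comp (sigmaReal.{w} hE 1) = sigmaOne hE :=
  AddMonoidHom.ext (hodgeCohomologyOneAddEquiv_sigmaReal_one hE)

/-- `σ_0(x) = 0 ↔ Tr(x) = 0`. [cite: BuchweitzFlenner2003, §1 (σ_0)] -/
theorem sigmaReal_zero_eq_zero_iff (x : Ext.{w} E E 2) : sigmaReal hE 0 x = 0 ↔ sigmaZero hE x = 0 := by
  rw [← hodgeCohomologyZeroAddEquiv_sigmaReal_zero hE x,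
    map_eq_zero_iff _ (hodgeCohomologyZeroAddEquiv X 2).injective]

/-- `σ_1(x) = 0 ↔ sigmaOne(x) = 0`. [cite: BuchweitzFlenner2003, Def. 4.1] -/
theorem sigmaReal_one_eq_zero_iff (x : Ext.{w} E E 2) : sigmaReal hE 1 x = 0 ↔ sigmaOne hE x = 0 := by
  rw [← hodgeCohomologyOneAddEquiv_sigmaReal_one hE x,
    map_eq_zero_iff _ (hodgeCohomologyOneAddEquiv X 3).injective]

/-- `0`-semiregular in the uniform family `↔` the tree's `IsZeroSemiregular` (`Tr` injective on `Ext²`).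
[cite: BuchweitzFlenner2003, §1 (k-semiregular)] -/
theorem isHigherSemiregular_zero_iff : IsHigherSemiregular.{w} hE 0 ↔ IsZeroSemiregular hE := by
  rw [IsHigherSemiregular, IsZeroSemiregular, injective_iff_map_eq_zero, injective_iff_map_eq_zero]
  exact forall_congr' fun x => by rw [← sigmaReal_zero_eq_zero_iff hE x]

/-- `1`-semiregular in the uniform family `↔` the tree's `IsOneSemiregular` (`σ_1` injective).
[cite: BuchweitzFlenner2003, §1 (k-semiregular)] -/
theorem isHigherSemiregular_one_iff : IsHigherSemiregular.{w} hE 1 ↔ IsOneSemiregular hE := by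
  rw [IsHigherSemiregular, IsOneSemiregular, injective_iff_map_eq_zero, injective_iff_map_eq_zero]
  exact forall_congr' fun x => by rw [← sigmaReal_one_eq_zero_iff hE x]

/-- `{0, 1}`-semiregular in the uniform family `↔` the tree's `IsZeroOneSemiregular`
(`(σ_0, σ_1)` injective). [cite: BuchweitzFlenner2003, §5 (I-semiregular)] -/
theorem isISemiregular_zero_one_iff : IsISemiregular.{w} hE {0, 1} ↔ IsZeroOneSemiregular hE := by
  rw [isZeroOneSemiregular_iff]
  refine forall_congr' fun x => ?_
  rw [← sigmaReal_zero_eq_zero_iff hE x, ← sigmaReal_one_eq_zero_iff hE x]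
  constructor
  · intro h h0 h1
    refine h fun q hq => ?_
    rcases hq with rfl | hq
    · exact h0
    · rw [Set.mem_singleton_iff.1 hq]
      exact h1
  · intro h hx
    exact h (hx 0 (Set.mem_insert 0 {1})) (hx 1 (Set.mem_insert_of_mem 0 rfl))

/-- **`{0,1}`-semiregular ⇒ semiregular**: the tree's `IsZeroOneSemiregular` (injectivity of
`(Tr, σ_1) : Ext²(E, E) → H²(X, 𝒪_X) × H³(X, Ω¹)`) implies injectivity of the full semiregularity map.
[cite: BuchweitzFlenner2003, §5] -/
theorem IsZeroOneSemiregular.isSemiregularReal (h : IsZeroOneSemiregular.{w} hE) :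
    IsSemiregularReal hE :=
  IsISemiregular.isSemiregularReal hE ((isISemiregular_zero_one_iff hE).2 h)

/-- `0`-semiregular (`Tr` injective, Mukai–Artamkin) ⇒ semiregular. [cite: BuchweitzFlenner2003, §1] -/
theorem IsZeroSemiregular.isSemiregularReal (h : IsZeroSemiregular.{w} hE) : IsSemiregularReal hE :=
  IsZeroOneSemiregular.isSemiregularReal hE (h.isZeroOneSemiregular hE)

/-- `1`-semiregular ⇒ semiregular. [cite: BuchweitzFlenner2003, §1] -/
theorem IsOneSemiregular.isSemiregularReal (h : IsOneSemiregular.{w} hE) : IsSemiregularReal hE :=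
  IsZeroOneSemiregular.isSemiregularReal hE (h.isZeroOneSemiregular hE)

end LowDegrees

/-! ### Finite dimension: only the degrees `q ≤ dim X − 2` matter -/

section FiniteDimension

variable [HasExt.{w} X.left.Modules] {E : X.left.Modules} (hE : IsFiniteLocallyFree E)

/-- **Grothendieck vanishing kills the high components**: on a noetherian `X` of dimension `< q + 2`,
`H^{q+2}(X, Ω^q) = 0`, so `σ_q = 0`. [cite: Hartshorne1977, III Thm. 2.7] -/
theorem sigmaReal_eq_zero_of_lt [IsNoetherian X.left] {q : ℕ}
    (hq : topologicalKrullDim X.left < (q + 2 : ℕ)) : sigmaReal.{w} hE q = 0 := by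
  haveI := subsingleton_hodgeCohomology_of_lt X q (q + 2) hq
  exact AddMonoidHom.ext fun x => Subsingleton.elim _ _

/-- **On a noetherian scheme of dimension `< n + 2`, semiregular `↔` `{0, …, n−1}`-semiregular**: the
components `σ_q`, `q ≥ n`, vanish identically (Buchweitz–Flenner §5 accordingly only consider
`I ⊆ {0, …, dim X}`). [cite: BuchweitzFlenner2003, §5 (I-semiregular)] [cite: Hartshorne1977, III Thm. 2.7] -/
theorem isSemiregularReal_iff_isISemiregular_Iio [IsNoetherian X.left] {n : ℕ}
    (hn : topologicalKrullDim X.left < (n + 2 : ℕ)) :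
    IsSemiregularReal.{w} hE ↔ IsISemiregular hE (Set.Iio n) := by
  refine ⟨fun h => h.isISemiregular_of_eq_zero hE fun q hq => sigmaReal_eq_zero_of_lt hE
    (lt_of_lt_of_le hn ?_), fun h => h.isSemiregularReal hE⟩
  rw [Set.mem_Iio, not_lt] at hq
  exact_mod_cast Nat.add_le_add_right hq 2

/-- **In dimension `≤ 1` semiregular `↔` `Ext²(E, E) = 0`**: on a noetherian `X` with `dim X < 2` every
component `σ_q` lands in `H^{q+2}(X, Ω^q) = 0`, so the semiregularity map is injective iff its source
vanishes (as it does for vector bundles on curves, `Ext²(E, E) = H²(X, 𝓔nd E) = 0`).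
[cite: BuchweitzFlenner2003, Def. 4.1] [cite: Hartshorne1977, III Thm. 2.7] -/
theorem isSemiregularReal_iff_forall_eq_zero_of_lt_two [IsNoetherian X.left]
    (h2 : topologicalKrullDim X.left < (2 : ℕ)) :
    IsSemiregularReal.{w} hE ↔ ∀ x : Ext.{w} E E 2, x = 0 := by
  rw [isSemiregularReal_iff_isISemiregular_Iio hE (n := 0) h2]
  exact ⟨fun h x => h x fun q hq => absurd (Set.mem_Iio.1 hq) (Nat.not_lt_zero q),
    fun h x _ => h x⟩

end FiniteDimension

/-! ### The same comparisons under the names of the parallel revision of this file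

An earlier, parallel revision of this file (superseded by the present one at the gate) exposed the
low-degree comparisons and the `I`-semiregularity dictionary under the following names; they are kept
as one-line corollaries so that either vocabulary works. -/

section Compat

variable [HasExt.{w} X.left.Modules] {E : X.left.Modules} (hE : IsFiniteLocallyFree E)

/-- `sigmaHigher hE 0 x = 0 ↔ Tr x = 0` (= `sigmaReal_zero_eq_zero_iff`). [cite: BuchweitzFlenner2003, §1 (σ_0)] -/
theorem sigmaHigher_zero_eq_zero_iff (x : Ext.{w} E E 2) : sigmaHigher hE 0 x = 0 ↔ sigmaZero hE x = 0 :=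
  sigmaReal_zero_eq_zero_iff hE x

/-- `sigmaHigher hE 1 x = 0 ↔ sigmaOne x = 0` (= `sigmaReal_one_eq_zero_iff`). [cite: BuchweitzFlenner2003, Def. 4.1] -/
theorem sigmaHigher_one_eq_zero_iff (x : Ext.{w} E E 2) : sigmaHigher hE 1 x = 0 ↔ sigmaOne hE x = 0 :=
  sigmaReal_one_eq_zero_iff hE x

/-- `I = ℕ`: `I`-semiregular `↔` semiregular (= `isISemiregular_univ_iff_isSemiregularReal`).
[cite: BuchweitzFlenner2003, §5 (I-semiregular)] -/
theorem isISemiregular_univ_iff : IsISemiregular.{w} hE Set.univ ↔ IsSemiregularReal hE :=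
  isISemiregular_univ_iff_isSemiregularReal hE

/-- `I = {0, 1}`: `I`-semiregular `↔` the tree's `IsZeroOneSemiregular` (= `isISemiregular_zero_one_iff`).
[cite: BuchweitzFlenner2003, §5 (I-semiregular)] -/
theorem isISemiregular_zeroOne_iff : IsISemiregular.{w} hE {0, 1} ↔ IsZeroOneSemiregular hE :=
  isISemiregular_zero_one_iff hE

/-- `I = {0}`: `I`-semiregular `↔` the tree's `IsZeroSemiregular` (`Tr` injective on `Ext²`).
[cite: BuchweitzFlenner2003, §1 (k-semiregular)] -/
theorem isISemiregular_zero_iff : IsISemiregular.{w} hE {0} ↔ IsZeroSemiregular hE := by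
  rw [← isHigherSemiregular_iff_isISemiregular_singleton, isHigherSemiregular_zero_iff]

/-- `I = {1}`: `I`-semiregular `↔` the tree's `IsOneSemiregular` (`σ_1` injective).
[cite: BuchweitzFlenner2003, §1 (k-semiregular)] -/
theorem isISemiregular_one_iff : IsISemiregular.{w} hE {1} ↔ IsOneSemiregular hE := by
  rw [← isHigherSemiregular_iff_isISemiregular_singleton, isHigherSemiregular_one_iff]

/-- **Semiregularity through the tree's low-degree maps**: `E` is semiregular iff
`Tr x = 0`, `σ_1 x = 0` (the maps `sigmaZero`, `sigmaOne` of `AtiyahClassTraceReal.lean`) and `σ_q x = 0`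
for all `q ≥ 2` force `x = 0`. [cite: BuchweitzFlenner2003, Def. 4.1] -/
theorem isSemiregularReal_iff_sigma :
    IsSemiregularReal hE ↔ ∀ x : Ext.{w} E E 2, sigmaZero hE x = 0 → sigmaOne hE x = 0 →
      (∀ q, 2 ≤ q → sigmaReal hE q x = 0) → x = 0 := by
  rw [isSemiregularReal_iff]
  constructor
  · intro h x h0 h1 hq
    refine h x fun q => ?_
    match q with
    | 0 => exact (sigmaReal_zero_eq_zero_iff hE x).2 h0
    | 1 => exact (sigmaReal_one_eq_zero_iff hE x).2 h1
    | q + 2 => exact hq (q + 2) (Nat.le_add_left 2 q)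
  · intro h x hx
    exact h x ((sigmaReal_zero_eq_zero_iff hE x).1 (hx 0)) ((sigmaReal_one_eq_zero_iff hE x).1 (hx 1))
      fun q _ => hx q

end Compat

end Literature.AlgebraicGeometry.HodgeTheory

end
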